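import Literature.Probability.RandomPlanarGeometry.HexSAWPolygonSupermult
import Literature.Analysis.Asymptotics.SupermultiplicativeDoubling
import HarnessLib

/-!
# Madras' doubling bootstrap for honeycomb polygons: a `√N`-gain join inequality `c√N·q_N(ℍ)² ≤ q_{2N+K}(ℍ)` (even `N`)
# implies `q_N(ℍ) ≤ A · N^{−1/2} · μ_ℍ^N = A · N^{−1/2} · (2+√2)^{N/2}` (stub S6ℍ of the line «HEX-MADRAS», unconditional as an implication)

Topic `Literature/Probability/RandomPlanarGeometry` (lane «pcv-sawmu», a-p4 g12; the honeycomb twin of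
`SAWTriangularPolygonMadrasBootstrap.lean` (a-p4 g9, `triPolygonNumber_le_rpow_of_joinIneq`), on top of `HexSAWPolygonSupermult.lean`
(`HexBW.hexPolygonNumber N = q_N(ℍ)`, `hexPolygonNumber_eq_zero_of_odd`, `hexPolygonNumber_eq_hexPolygonCount : N·q_N = 3·p_N`),
`HexSAWPolygonNumberRate.lean` (`HV.tendsto_log_hexPolygonNumber_div : log q_{2K}(ℍ)/(2K) → log μ_ℍ`),
`HexSAWBrickWallPolygonGrowth.lean` (`abs_log_hexPolygonCount_sub_le`: `p_N(ℍ) > 0` for even `N ≥ 26`), `HexSAWTheorem1.lean`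
(`μ_ℍ = √(2+√2)`, Duminil-Copin–Smirnov) and the model-free doubling lemma
`Literature.Analysis.Asymptotics.Madras1995_doubling_polynomial` (`(N^θ a_N)² ≤ (2N)^θ a_{2N}`, `a_n^{1/n} → λ` ⟹ `a_N ≤ N^{−θ} λ^N`)).

Source: N. Madras, *A rigorous bound on the critical exponent for the number of lattice trees, animals, and polygons*, J. Stat. Phys. 78
(1995) 681–699, §2 (on `ℤ²`: the join inequality with a `√n` gain and the a-priori bound from the "superadditivity-type inequality";
analytic half printed again in N. Madras, J. Phys. Conf. Ser. 42 (2006) §3 (3.5)–(3.7)); tree editions: `ℤ²` `SAWPolygonDoublingBootstrap.lean`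
(`SAW.bootstrap2`), `𝕋` `SAWTriangularPolygonMadrasBootstrap.lean`.  Here: the honeycomb lattice `ℍ` (brick-wall frame), with
`q_N(ℍ) = HexBW.hexPolygonNumber N` (zero for odd `N`), for an ARBITRARY join inequality `c √N q_N² ≤ q_{2N+K}` over the EVEN `N ≥ N₀` with an
even edge budget `K` — the combinatorial stubs S1ℍ–S5ℍ of the lane's design note `DESIGN-hex-madras-sqrtN.md` are what would supply it; this
file is their analytic consumer, proved now.  Parity is the one difference from `𝕋`: the auxiliary sequence is `a_M = c · q_{2(M−K/2)}` with
growth constant `μ_ℍ²`.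

## What is proved (namespace `…SAW.HexBW`; all `theorem`s, axioms standard)

* `hexPolygonNumber_pos_of_even (hN : 26 ≤ N) (hNe : Even N) : 0 < q_N(ℍ)`;
* **`hexPolygonNumber_le_rpow_of_joinIneq (hc : 0 < c) (hK : Even K) (hJ : ∀ N ≥ N₀, Even N → c·√N·q_N² ≤ q_{2N+K}) :
  ∃ A, ∀ N ≥ 1, (q_N : ℝ) ≤ A · N^{−1/2} · μ_ℍ^N`** (Madras' bootstrap on `ℍ`);
* **`hexPolygonNumber_le_rpow_sqrt_of_joinIneq`** — the same with the Duminil-Copin–Smirnov value, `q_N(ℍ) ≤ A · N^{−1/2} · √(2+√2)^N`.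

Printed anchors: [cite: Madras1995LatticeAnimalsExponent, §2 (primary, not held: θ ≥ 1/2 on ℤ² by polygon joining)]
[cite: Hammond2015SAPJoining, §2 (arXiv v5 p. 4: "he has shown in [26] using a polygon joining technique that θ_n ≥ 1/2 − o(1) for d = 2";
§4.1 Definition 4.3 p. 20 (Madras join), Definition 4.8 / Lemma 4.9 pp. 24–25)] [cite: DuminilCopinSmirnov2012, Theorem 1].
Label (lane): the ℍ edition of the analytic half, implication form — CONSOLIDATION-BY-TRANSFER (no new fact is claimed).
-/

noncomputable section

open Filter Topology Finset Literature.Probability.LatticeModels Literature.Analysis.Asymptotics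

namespace Literature.Probability.RandomPlanarGeometry.SAW

namespace HexBW

/-! ### Positivity of `q_N(ℍ)` for large even `N` -/

/-- `q_N(ℍ) > 0` for even `N ≥ 26` (via `N q_N = 3 p_N` and the lane's two-bridge lower bound `p_N(ℍ) > 0`).
[cite: MadrasSlade1993, §3.2 eq. (3.2.1) p. 63 and Theorem 3.2.4 p. 65] -/
theorem hexPolygonNumber_pos_of_even {N : ℕ} (hN : 26 ≤ N) (hNe : Even N) : 0 < hexPolygonNumber N := by
  have h := hexPolygonNumber_eq_hexPolygonCount (N := N) (by omega)
  have hpos : (0 : ℝ) < (hexPolygonCount N : ℝ) := (abs_log_hexPolygonCount_sub_le hN hNe).1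
  have hpos' : 0 < hexPolygonCount N := by exact_mod_cast hpos
  by_contra h0
  push Not at h0
  have hz : hexPolygonNumber N = 0 := by omega
  rw [hz, mul_zero] at h
  omega

/-! ### The bootstrap -/

/-- **Madras' doubling bootstrap on the honeycomb lattice.**  If for some `c > 0`, an even `K` and `N₀` the polygon numbers up to
translation satisfy the join inequality with a `√N` gain, `c · √N · q_N(ℍ)² ≤ q_{2N+K}(ℍ)` for all even `N ≥ N₀`, then
`q_N(ℍ) ≤ A · N^{−1/2} · μ_ℍ^N` for every `N ≥ 1`, for some constant `A`.  (Auxiliary sequence `a_M = c · q_{2(M − K/2)}(ℍ)`,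
`(√M a_M)² ≤ √(2M) a_{2M}`, `a_M^{1/M} → μ_ℍ²`, then `Madras1995_doubling_polynomial` with `θ = 1/2`; odd `N`: `q_N = 0`.)
[cite: Madras1995LatticeAnimalsExponent, §2 (primary, not held: θ ≥ 1/2 on ℤ² by polygon joining; the a-priori bound from the
superadditivity-type inequality)] [cite: Hammond2015SAPJoining, §2 (arXiv v5 p. 4: "he has shown in [26] using a polygon joining technique
that θ_n ≥ 1/2 − o(1) for d = 2")] — ℍ edition of the analytic half, implication form. -/
theorem hexPolygonNumber_le_rpow_of_joinIneq {c : ℝ} {K N₀ : ℕ} (hc : 0 < c) (hK : Even K)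
    (hJ : ∀ N : ℕ, N₀ ≤ N → Even N →
      c * Real.sqrt N * (hexPolygonNumber N : ℝ) ^ 2 ≤ hexPolygonNumber (2 * N + K)) :
    ∃ A : ℝ, ∀ N : ℕ, 1 ≤ N → (hexPolygonNumber N : ℝ) ≤ A * (N : ℝ) ^ (-(1 / 2 : ℝ)) * hexConnectiveConstant ^ N := by
  obtain ⟨k, hk⟩ := hK
  set μ : ℝ := hexConnectiveConstant with hμ
  have hμ1 : 1 ≤ μ := one_le_hexConnectiveConstant
  have hμ0 : 0 < μ := by positivity
  set q : ℕ → ℝ := fun N => (hexPolygonNumber N : ℝ) with hqdef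
  have hq0 : ∀ N, 0 ≤ q N := fun N => Nat.cast_nonneg _
  -- the threshold
  set M₁ : ℕ := N₀ + 2 * k + 26 with hM₁
  -- the auxiliary sequence `a_M = c · q_{2(M−k)}`
  set a : ℕ → ℝ := fun M => if M₁ ≤ M then c * q (2 * (M - k)) else 0 with hadef
  have ha0 : ∀ n, 1 ≤ n → 0 ≤ a n := fun n _ => by
    simp only [hadef]; split_ifs
    · exact mul_nonneg hc.le (hq0 _)
    · exact le_rfl
  have ha_of_ge : ∀ M, M₁ ≤ M → a M = c * q (2 * (M - k)) := fun M hM => by simp only [hadef]; rw [if_pos hM]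
  have hqpos_even : ∀ M, M₁ ≤ M → 0 < q (2 * (M - k)) := fun M hM => by
    show (0 : ℝ) < (hexPolygonNumber (2 * (M - k)) : ℝ)
    exact_mod_cast hexPolygonNumber_pos_of_even (by omega) ⟨M - k, by ring⟩
  -- (hsq): `(√M a_M)² ≤ √(2M) a_{2M}`
  have hsq : ∀ M : ℕ, 1 ≤ M → (((M : ℝ) ^ (1 / 2 : ℝ)) * a M) ^ 2 ≤ ((2 * M : ℕ) : ℝ) ^ (1 / 2 : ℝ) * a (2 * M) := by
    intro M hM1
    by_cases hM : M₁ ≤ M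
    · have h2M : M₁ ≤ 2 * M := by omega
      rw [ha_of_ge M hM, ha_of_ge (2 * M) h2M, ← Real.sqrt_eq_rpow, ← Real.sqrt_eq_rpow]
      -- the join inequality at `n = 2(M−k)`
      have hn₀ : N₀ ≤ 2 * (M - k) := by omega
      have hJ' := hJ (2 * (M - k)) hn₀ ⟨M - k, by ring⟩
      rw [show 2 * (2 * (M - k)) + K = 2 * (2 * M - k) by omega] at hJ'
      have hnpos : (0 : ℝ) < ((2 * (M - k) : ℕ) : ℝ) := by exact_mod_cast (show 0 < 2 * (M - k) by omega)
      have hsqrtn : 0 < Real.sqrt ((2 * (M - k) : ℕ) : ℝ) := Real.sqrt_pos.2 hnpos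
      -- `q_n² ≤ q_{2(2M−k)} / (c √n)`
      have hq2 : q (2 * (M - k)) ^ 2 ≤ q (2 * (2 * M - k)) / (c * Real.sqrt ((2 * (M - k) : ℕ) : ℝ)) := by
        rw [le_div_iff₀ (by positivity)]
        calc q (2 * (M - k)) ^ 2 * (c * Real.sqrt ((2 * (M - k) : ℕ) : ℝ))
            = c * Real.sqrt ((2 * (M - k) : ℕ) : ℝ) * q (2 * (M - k)) ^ 2 := by ring
          _ ≤ q (2 * (2 * M - k)) := hJ'
      -- `M ≤ √(2M) √n` since `M² ≤ 2M · 2(M−k)` iff `4k ≤ 3M`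
      have hgeo : (M : ℝ) ≤ Real.sqrt ((2 * M : ℕ) : ℝ) * Real.sqrt ((2 * (M - k) : ℕ) : ℝ) := by
        rw [← Real.sqrt_mul (by positivity)]
        apply Real.le_sqrt_of_sq_le
        have h1 : ((M : ℕ) : ℝ) ≤ 2 * ((2 * (M - k) : ℕ) : ℝ) := by
          have : M ≤ 2 * (2 * (M - k)) := by omega
          exact_mod_cast this
        have hM0 : (0 : ℝ) ≤ M := Nat.cast_nonneg _
        calc ((M : ℝ)) ^ 2 = (M : ℝ) * M := sq _
          _ ≤ (M : ℝ) * (2 * ((2 * (M - k) : ℕ) : ℝ)) := mul_le_mul_of_nonneg_left h1 hM0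
          _ = ((2 * M : ℕ) : ℝ) * ((2 * (M - k) : ℕ) : ℝ) := by push_cast; ring
      calc (Real.sqrt (M : ℝ) * (c * q (2 * (M - k)))) ^ 2 = (M : ℝ) * c ^ 2 * q (2 * (M - k)) ^ 2 := by
            rw [mul_pow, Real.sq_sqrt (Nat.cast_nonneg _)]; ring
        _ ≤ (M : ℝ) * c ^ 2 * (q (2 * (2 * M - k)) / (c * Real.sqrt ((2 * (M - k) : ℕ) : ℝ))) :=
            mul_le_mul_of_nonneg_left hq2 (by positivity)
        _ = (M : ℝ) / Real.sqrt ((2 * (M - k) : ℕ) : ℝ) * (c * q (2 * (2 * M - k))) := by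
            field_simp
        _ ≤ Real.sqrt ((2 * M : ℕ) : ℝ) * (c * q (2 * (2 * M - k))) := by
            apply mul_le_mul_of_nonneg_right _ (mul_nonneg hc.le (hq0 _))
            rw [div_le_iff₀ hsqrtn]; exact hgeo
    · -- below the threshold `a_M = 0`
      have : a M = 0 := by simp only [hadef]; rw [if_neg hM]
      rw [this, mul_zero, zero_pow two_ne_zero]
      exact mul_nonneg (Real.rpow_nonneg (Nat.cast_nonneg _) _) (ha0 _ (by omega))
  -- (hlim): `a_n^{1/n} → μ²`
  have hKlim : Tendsto (fun n : ℕ => n - k) atTop atTop := tendsto_sub_atTop_nat k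
  have hlog : Tendsto (fun n : ℕ => Real.log (a n) / n) atTop (𝓝 (Real.log (μ ^ 2))) := by
    -- `log a_n / n = log c / n + (log q_{2(n−k)} / (2(n−k))) · (2(n−k)/n)`
    have h1 : Tendsto (fun n : ℕ => Real.log c / n) atTop (𝓝 0) :=
      tendsto_const_nhds.div_atTop tendsto_natCast_atTop_atTop
    have h2 : Tendsto (fun n : ℕ => Real.log (q (2 * (n - k))) / ((2 * (n - k) : ℕ) : ℝ)) atTop (𝓝 (Real.log μ)) :=
      HV.tendsto_log_hexPolygonNumber_div.comp hKlim
    have h3 : Tendsto (fun n : ℕ => (((2 * (n - k) : ℕ) : ℝ)) / n) atTop (𝓝 2) := by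
      have h31 : Tendsto (fun n : ℕ => (2 : ℝ) - (2 * k : ℝ) / n) atTop (𝓝 (2 - 0)) :=
        tendsto_const_nhds.sub (tendsto_const_nhds.div_atTop tendsto_natCast_atTop_atTop)
      rw [sub_zero] at h31
      refine h31.congr' ?_
      filter_upwards [eventually_ge_atTop (k + 1)] with n hn
      have hn0 : (n : ℝ) ≠ 0 := by exact_mod_cast (show n ≠ 0 by omega)
      rw [Nat.cast_mul, Nat.cast_sub (by omega)]
      push_cast
      field_simp
    have h4 := h1.add (h2.mul h3)
    rw [zero_add, show Real.log μ * 2 = Real.log (μ ^ 2) by rw [Real.log_pow]; push_cast; ring] at h4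
    refine h4.congr' ?_
    filter_upwards [eventually_ge_atTop (M₁ + 1)] with n hn
    have hqpos : 0 < q (2 * (n - k)) := hqpos_even n (by omega)
    have hn0 : (n : ℝ) ≠ 0 := by exact_mod_cast (show n ≠ 0 by omega)
    have hnK0 : ((2 * (n - k) : ℕ) : ℝ) ≠ 0 := by exact_mod_cast (show 2 * (n - k) ≠ 0 by omega)
    rw [ha_of_ge n (by omega), Real.log_mul hc.ne' hqpos.ne']
    field_simp
  have hlim : Tendsto (fun n : ℕ => a n ^ (1 / (n : ℝ))) atTop (𝓝 (μ ^ 2)) := by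
    have hexp := (Real.continuous_exp.tendsto _).comp hlog
    rw [Real.exp_log (by positivity : (0 : ℝ) < μ ^ 2)] at hexp
    refine hexp.congr' ?_
    filter_upwards [eventually_ge_atTop (M₁ + 1)] with n hn
    have hqpos : 0 < q (2 * (n - k)) := hqpos_even n (by omega)
    have hapos : 0 < a n := by rw [ha_of_ge n (by omega)]; exact mul_pos hc hqpos
    simp only [Function.comp]
    rw [Real.rpow_def_of_pos hapos, one_div, ← div_eq_mul_inv]
  -- apply the doubling lemma with `θ = 1/2`, `λ = μ²`
  have hmain : ∀ N : ℕ, 1 ≤ N → a N ≤ (N : ℝ) ^ (-(1 / 2 : ℝ)) * (μ ^ 2) ^ N :=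
    fun N hN => Madras1995_doubling_polynomial ha0 hsq hlim hN
  -- constants
  set N₁ : ℕ := 2 * M₁ with hN₁
  set B : ℝ := ∑ j ∈ range N₁, q j * j with hB
  have hB0 : 0 ≤ B := Finset.sum_nonneg fun j _ => mul_nonneg (hq0 j) (Nat.cast_nonneg _)
  refine ⟨Real.sqrt 2 * μ ^ (2 * k) / c + B, fun N hN => ?_⟩
  have hN0 : (0 : ℝ) < N := by exact_mod_cast (show 0 < N by omega)
  have hrpow : (N : ℝ) ^ (-(1 / 2 : ℝ)) = 1 / Real.sqrt N := by
    rw [Real.rpow_neg hN0.le, ← Real.sqrt_eq_rpow, one_div]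
  have hsqrtN : 0 < Real.sqrt N := Real.sqrt_pos.2 hN0
  have hN1 : (1 : ℝ) ≤ N := by exact_mod_cast hN
  have hsqrt_le : Real.sqrt (N : ℝ) ≤ N := by
    calc Real.sqrt (N : ℝ) ≤ Real.sqrt ((N : ℝ) ^ 2) := Real.sqrt_le_sqrt (by nlinarith)
      _ = N := Real.sqrt_sq hN0.le
  have hA10 : 0 ≤ Real.sqrt 2 * μ ^ (2 * k) / c := by positivity
  have hfac0 : 0 ≤ (N : ℝ) ^ (-(1 / 2 : ℝ)) * μ ^ N := by positivity
  by_cases hbig : N₁ ≤ N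
  · rcases Nat.even_or_odd N with ⟨m, hm⟩ | hodd
    · -- even `N = 2m`, `M := m + k ≥ M₁`: `c q_N = a_M ≤ M^{-1/2} μ^{2M} ≤ √2 N^{-1/2} μ^{2k} μ^N`
      have hMge : M₁ ≤ m + k := by omega
      have h1 := hmain (m + k) (by omega)
      rw [ha_of_ge (m + k) hMge, show 2 * (m + k - k) = N by omega] at h1
      have hm0 : (0 : ℝ) < ((m + k : ℕ) : ℝ) := by exact_mod_cast (show 0 < m + k by omega)
      have hm0' : (0 : ℝ) < (m : ℝ) := by exact_mod_cast (show 0 < m by omega)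
      -- `(m+k)^{-1/2} ≤ m^{-1/2} = √2 · N^{-1/2}`
      have hmono : ((m + k : ℕ) : ℝ) ^ (-(1 / 2 : ℝ)) ≤ Real.sqrt 2 * (N : ℝ) ^ (-(1 / 2 : ℝ)) := by
        rw [Real.rpow_neg hm0.le, Real.rpow_neg hN0.le, ← Real.sqrt_eq_rpow, ← Real.sqrt_eq_rpow]
        have hNm : (N : ℝ) = 2 * m := by rw [hm]; push_cast; ring
        have hs : Real.sqrt (N : ℝ) = Real.sqrt 2 * Real.sqrt m := by
          rw [hNm, Real.sqrt_mul (by norm_num : (0 : ℝ) ≤ 2)]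
        have h2pos : 0 < Real.sqrt 2 := Real.sqrt_pos.2 (by norm_num)
        rw [hs, mul_inv, ← mul_assoc, mul_inv_cancel₀ h2pos.ne', one_mul]
        exact inv_anti₀ (Real.sqrt_pos.2 hm0') (Real.sqrt_le_sqrt (by exact_mod_cast (show m ≤ m + k by omega)))
      have hpow : (μ ^ 2) ^ (m + k) = μ ^ (2 * k) * μ ^ N := by
        rw [← pow_mul, show 2 * (m + k) = 2 * k + N by omega, pow_add]
      have h2 : c * q N ≤ Real.sqrt 2 * (N : ℝ) ^ (-(1 / 2 : ℝ)) * (μ ^ (2 * k) * μ ^ N) := by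
        calc c * q N ≤ ((m + k : ℕ) : ℝ) ^ (-(1 / 2 : ℝ)) * (μ ^ 2) ^ (m + k) := h1
          _ ≤ Real.sqrt 2 * (N : ℝ) ^ (-(1 / 2 : ℝ)) * (μ ^ 2) ^ (m + k) :=
              mul_le_mul_of_nonneg_right hmono (by positivity)
          _ = Real.sqrt 2 * (N : ℝ) ^ (-(1 / 2 : ℝ)) * (μ ^ (2 * k) * μ ^ N) := by rw [hpow]
      have h3 : q N ≤ Real.sqrt 2 * μ ^ (2 * k) / c * (N : ℝ) ^ (-(1 / 2 : ℝ)) * μ ^ N := by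
        rw [div_mul_eq_mul_div, div_mul_eq_mul_div, le_div_iff₀ hc]
        calc q N * c = c * q N := mul_comm _ _
          _ ≤ Real.sqrt 2 * (N : ℝ) ^ (-(1 / 2 : ℝ)) * (μ ^ (2 * k) * μ ^ N) := h2
          _ = Real.sqrt 2 * μ ^ (2 * k) * (N : ℝ) ^ (-(1 / 2 : ℝ)) * μ ^ N := by ring
      calc q N ≤ Real.sqrt 2 * μ ^ (2 * k) / c * (N : ℝ) ^ (-(1 / 2 : ℝ)) * μ ^ N := h3
        _ ≤ (Real.sqrt 2 * μ ^ (2 * k) / c + B) * (N : ℝ) ^ (-(1 / 2 : ℝ)) * μ ^ N := by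
            nlinarith [mul_nonneg hB0 hfac0]
    · -- odd `N ≥ 3`: `q_N = 0`
      have hz : (hexPolygonNumber N : ℝ) = 0 := by
        exact_mod_cast hexPolygonNumber_eq_zero_of_odd (by omega) hodd
      rw [hz]
      exact mul_nonneg (mul_nonneg (add_nonneg hA10 hB0) (by positivity)) (by positivity)
  · -- small `N`: `q_N ≤ q_N · N ≤ B`, so `q_N ≤ B · N^{-1/2} μ^N`
    have hNlt : N < N₁ := by omega
    have hqB : q N * N ≤ B := by
      rw [hB]
      exact Finset.single_le_sum (f := fun j => q j * (j : ℝ)) (fun j _ => mul_nonneg (hq0 j) (Nat.cast_nonneg _))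
        (Finset.mem_range.2 hNlt)
    have hstep : q N ≤ B * (N : ℝ) ^ (-(1 / 2 : ℝ)) * μ ^ N := by
      rw [hrpow]
      have hμN : 1 ≤ μ ^ N := one_le_pow₀ hμ1
      calc q N = q N * N * (1 / (N : ℝ)) * 1 := by field_simp
        _ ≤ q N * N * (1 / Real.sqrt N) * μ ^ N := by
            apply mul_le_mul _ hμN zero_le_one (by positivity)
            apply mul_le_mul_of_nonneg_left _ (mul_nonneg (hq0 N) hN0.le)
            exact one_div_le_one_div_of_le hsqrtN hsqrt_le
        _ ≤ B * (1 / Real.sqrt N) * μ ^ N := by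
            apply mul_le_mul_of_nonneg_right _ (by positivity)
            exact mul_le_mul_of_nonneg_right hqB (by positivity)
    calc q N ≤ B * (N : ℝ) ^ (-(1 / 2 : ℝ)) * μ ^ N := hstep
      _ ≤ (Real.sqrt 2 * μ ^ (2 * k) / c + B) * (N : ℝ) ^ (-(1 / 2 : ℝ)) * μ ^ N := by
          nlinarith [mul_nonneg hA10 hfac0]

/-- **The same with the Duminil-Copin–Smirnov value**: a `√N`-gain join inequality on the even lengths gives
`q_N(ℍ) ≤ A · N^{−1/2} · √(2+√2)^N` for every `N ≥ 1`.
[cite: Madras1995LatticeAnimalsExponent, §2 (primary, not held)] [cite: Hammond2015SAPJoining, §2 (arXiv v5 p. 4)]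
[cite: DuminilCopinSmirnov2012, Theorem 1] -/
theorem hexPolygonNumber_le_rpow_sqrt_of_joinIneq {c : ℝ} {K N₀ : ℕ} (hc : 0 < c) (hK : Even K)
    (hJ : ∀ N : ℕ, N₀ ≤ N → Even N →
      c * Real.sqrt N * (hexPolygonNumber N : ℝ) ^ 2 ≤ hexPolygonNumber (2 * N + K)) :
    ∃ A : ℝ, ∀ N : ℕ, 1 ≤ N →
      (hexPolygonNumber N : ℝ) ≤ A * (N : ℝ) ^ (-(1 / 2 : ℝ)) * Real.sqrt (2 + Real.sqrt 2) ^ N := by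
  rw [← hexConnectiveConstant_eq_of_thm1 DuminilCopinSmirnov2012_thm1_holds]
  exact hexPolygonNumber_le_rpow_of_joinIneq hc hK hJ

end HexBW

end Literature.Probability.RandomPlanarGeometry.SAW

end
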